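import Mathlib
import Summits.Ventures.HodgeRepro.Tier4.Target
import Summits.Ventures.HodgeRepro.Tier4.Line3.Defs
import Summits.Ventures.HodgeRepro.Tier4.Line3.DefsLemmas
import Summits.Ventures.HodgeRepro.Tier4.Line3.MainClassReps
import Summits.Ventures.HodgeRepro.Tier4.Line3.OffMainOrbit
import Summits.Ventures.HodgeRepro.Tier4.Line3.RayMinor
import Summits.Ventures.HodgeRepro.Tier4.Line3.ScalarFamily
import Summits.Ventures.HodgeRepro.Tier4.Line3.CopyRemainder

/-!
# Tier4/Line3/NormRayCopies — the scalar family is the copies of the centre plus the copies of the NON-NORM ray elements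

Blind re-derivation cell `pub-hodge-repro`, Tier 4 «PROVE THE STEP», LINE L3, seat t4-L3-p2 (g2).  The displayed clause
`RemainderOff` of v0.41 (CopyRemainder p682977, (R-b)) quantifies over `ScalarFamily xm ∖ Copies S xm`.  This module shows what
that set is made of: a ray element `y` (`Gram(y) = ρ · Gram(xm)`) whose ratio `ρ` is a NORM from `E′` (`ρ = c(s) s`, `s ≠ 0`)
has the Gram matrix of `s • xm`, hence lies in the orbit of `s • xm` by Witt for the symmetric centre (`orbitOf_eq_of_gram_eq`,
OffMainOrbit), so every per-slot scalar copy of it is a copy of the centre by the scalars `β_j t_j s`: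

* **`orbitOf_smul_mem_copies_of_norm`** — such copies lie in `Copies Set.univ xm`;
* **`scalarFamily_subset_copies_union_nonNorm`** — `ScalarFamily xm ⊆ Copies univ xm ∪ NonNormRayCopies xm`, where
  `NonNormRayCopies xm` are the copies of ray elements whose ratio is NOT a norm;
* hence `RemainderOff`'s set is contained in `(Copies univ xm ∖ Copies S xm) ∪ NonNormRayCopies xm`
  (`scalarFamily_diff_copies_subset`): the part of the family that the admissible scalars `S` miss, plus the non-norm ray copies.

Nothing here says anything about the status of the Hodge conjecture for CM abelian varieties, which is NOT proved
(HC_CM is NOT proved by anyone in this repository).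
-/

set_option autoImplicit false

noncomputable section

namespace Summit.Ventures.HodgeRepro.Tier4.Line3

open Summit.Ventures.HodgeRepro.Tier4
open Matrix NumberField
open scoped ComplexConjugate

namespace T4Data

variable (X : T4Data)

/-- A scaled symmetric tuple is symmetric and independent. -/
theorem linearIndependent_smul_pair {xm : X.Tuple} (hab : LinearIndependent X.E ![xm 0, xm 1]) {s : X.E}
    (hs : s ≠ 0) : LinearIndependent X.E ![s • xm 0, s • xm 1] := by
  have := hab.units_smul (fun _ => Units.mk0 s hs)
  convert this using 1
  funext i
  fin_cases i <;> rfl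

/-- **A copy of a ray element whose ratio is a norm is a copy of the centre.**  `Gram(y) = c(s) s · Gram(xm) = Gram(s • xm)` ⇒
`y` is in the orbit of `s • xm` (Witt for the symmetric centre) ⇒ `β • y` is a copy of `xm` by the scalars `β_j t_j s`. -/
theorem orbitOf_smul_mem_copies_of_norm (xm : X.Tuple) (h02 : xm 2 = xm 0) (h13 : xm 3 = xm 1)
    (hab : LinearIndependent X.E ![xm 0, xm 1]) (y : X.Tuple) (β : Fin 4 → X.E) (hβ : ∀ j, β j ≠ 0) {s : X.E}
    (hs : s ≠ 0) (hy : ∀ i j, X.gram y i j = (X.c s * s) * X.gram xm i j) :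
    X.orbitOf (X.lines fun j => β j • y j) ∈ X.Copies Set.univ xm := by
  -- `y` has the Gram matrix of `s • xm`
  have hG : X.gram y = X.gram (fun j => s • xm j) := by
    ext i j
    rw [hy i j, X.gram_smul xm s i j]
  have horb : X.orbitOf (X.lines y) = X.orbitOf (X.lines fun j => s • xm j) :=
    X.orbitOf_eq_of_gram_eq (fun j => s • xm j) y (by simp [h02]) (by simp [h13])
      (X.linearIndependent_smul_pair hab hs) hG
  obtain ⟨g, hg, hlines⟩ := X.exists_unitary_of_orbitOf_eq (fun j => s • xm j) horb.symm
  obtain ⟨t, ht, hyt⟩ := X.exists_torus_of_lines_eq hlines.symm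
  -- `y j = t j • (g *ᵥ (s • xm j))`, so `β j • y j = g *ᵥ ((β j * t j * s) • xm j)`
  refine ⟨fun j => β j * t j * s, Set.mem_univ _, fun j => mul_ne_zero (mul_ne_zero (hβ j) (ne_zero_of_norm_one X (ht j))) hs,
    ?_⟩
  have hcopy : (fun j => β j • y j) = fun j => g *ᵥ ((β j * t j * s) • xm j) := by
    funext j
    simp only [hyt j, Matrix.mulVec_smul, smul_smul, mul_assoc]
  rw [hcopy]
  exact Quot.sound ((X.orbitStepL_lines_iff (fun j => (β j * t j * s) • xm j) _).2 ⟨g, hg, rfl⟩)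

/-- The copies of ray elements whose ratio is NOT a norm from `E′`. -/
def NonNormRayCopies (xm : X.Tuple) : Set X.Orbit :=
  {o | ∃ (y : X.Tuple) (β : Fin 4 → X.E) (ρ : X.E), (∀ j, β j ≠ 0) ∧ (∀ i j, X.gram y i j = ρ * X.gram xm i j) ∧
    (∀ s : X.E, s ≠ 0 → ρ ≠ X.c s * s) ∧ X.orbitOf (X.lines (fun j => β j • y j)) = o}

/-- **THE SCALAR FAMILY = COPIES OF THE CENTRE ∪ COPIES OF NON-NORM RAY ELEMENTS.** -/
theorem scalarFamily_subset_copies_union_nonNorm (xm : X.Tuple) (h02 : xm 2 = xm 0) (h13 : xm 3 = xm 1)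
    (hab : LinearIndependent X.E ![xm 0, xm 1]) :
    X.ScalarFamily xm ⊆ X.Copies Set.univ xm ∪ X.NonNormRayCopies xm := by
  rintro o ⟨y, β, ρ, hβ, hy, rfl⟩
  by_cases hρ : ∃ s : X.E, s ≠ 0 ∧ ρ = X.c s * s
  · obtain ⟨s, hs, rfl⟩ := hρ
    exact Or.inl (X.orbitOf_smul_mem_copies_of_norm xm h02 h13 hab y β hβ hs hy)
  · refine Or.inr ⟨y, β, ρ, hβ, hy, fun s hs h => hρ ⟨s, hs, h⟩, rfl⟩

/-- **WHAT `RemainderOff` QUANTIFIES OVER**: the family minus the copies by the admissible scalars `S` is contained in the copies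
by the other scalars plus the non-norm ray copies. -/
theorem scalarFamily_diff_copies_subset (S : Set (Fin 4 → X.E)) (xm : X.Tuple) (h02 : xm 2 = xm 0) (h13 : xm 3 = xm 1)
    (hab : LinearIndependent X.E ![xm 0, xm 1]) :
    X.ScalarFamily xm \ X.Copies S xm ⊆ (X.Copies Set.univ xm \ X.Copies S xm) ∪ X.NonNormRayCopies xm := by
  rintro o ⟨ho, hoS⟩
  rcases X.scalarFamily_subset_copies_union_nonNorm xm h02 h13 hab ho with h | h
  · exact Or.inl ⟨h, hoS⟩
  · exact Or.inr h

end T4Data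

end Summit.Ventures.HodgeRepro.Tier4.Line3

end
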